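import Summits.CriticalPhenomena.SAWScalingLimit.Theorems.SAWDefectDecoherenceObservableToSLERTwoPieceAdmIdentificationComponent
import Summits.CriticalPhenomena.SAWScalingLimit.Theorems.SAWDefectDecoherenceObservableToSLERTwoPieceAdmIdentificationLimits
import Summits.CriticalPhenomena.SAWScalingLimit.Theorems.SAWDevelopingMapObservableToSLECanonicalTransferDictionary
import Literature.Probability.RandomPlanarGeometry.HexParafermionSpinShift
import HarnessLib

/-!
# Crux `SAWDefectDecoherence.ObservableToSLER` (stmt-CriticalPhenomena-14005), line
`bridge-gate-renewal` (r7), stub 5a3 `stub_twoPieceAdmIdentification`: the sub-family at a fixed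
mesh — boundary mid-edges, walks, and the two sandwich inclusions

Landing target:
`Summits/CriticalPhenomena/SAWScalingLimit/Theorems/SAWDefectDecoherenceObservableToSLERTwoPieceAdmIdentificationMesh.lean`
(`--supports stmt-CriticalPhenomena-14005`).  Sequel of `…TwoPieceAdmIdentificationComponent`
(the sub-family `subFamily Λ T δ v_a`) and `…TwoPieceAdmIdentificationLimits` (lattice curves).

Fixed-mesh facts about the sub-family (the component of the inner end `v_a` of the source mid-edge
in the deep vertices `{u ∈ Λ | dist(δ c_u, T) > 6δ}`, written out as a `Finset.filter`) that enter
the admissibility clauses of the two-piece admissible restriction limit and the sandwich: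

* `exists_ends_of_mem_hexDomainBoundary` — the two ends of a boundary mid-edge of a vertex family
  (`hexDomainBoundary`); `dist_smul_center_midpoint_le` — the inner end is within `δ` of the
  rescaled mid-edge;
* `nonempty_hexMidEdgeSAW_of_pathIn` — a lattice path inside a family between the inner ends of
  two distinct boundary mid-edges gives a mid-edge self-avoiding walk of the family (10472's
  dictionary `FloorRatio.exists_equiv_isPath_hexMidEdgeSAW`);
* `verts_subset_subFamily_of_far` — THE LOWER INCLUSION at a fixed mesh: a walk of `Λ` from the
  source mid-edge all of whose vertices are `> 6δ` away from the exclusion set `T` is a walk of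
  the sub-family;
* `range_latticeCurve_subset_cthickening_of_subset` — THE UPPER INCLUSION at a fixed mesh: the
  curve of a walk of the sub-family lies in the closed `δ`-neighbourhood of the subdomain;
* `dist_source_latticeCurve_le`, `dist_target_latticeCurve_le` — the curve of a walk starts and
  ends within `δ` of the rescaled end mid-edges.
-/

noncomputable section

open scoped Topology Classical
open Filter Set Metric
open Literature.Probability.LatticeModels (HexVertex hexGraph hexCenter Site polyline)
open Literature.Probability.RandomPlanarGeometry
open Literature.Probability.RandomPlanarGeometry.SAW
open Literature.Probability.Percolation (PathIn)

namespace Summit.CriticalPhenomena.SAWScalingLimit.Theorems.ObservableToSLER.TwoPiece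

open Summit.CriticalPhenomena.SAWScalingLimit.Theorems.ObservableToSLE.FloorRatio

/-! ### Boundary mid-edges -/

/-- **The ends of a boundary mid-edge**: a boundary mid-edge `e` of `Λ` is `{u, v}` with `v ∈ Λ`
(the INNER end), `u ∉ Λ` (the OUTER end), `u ∼ v`. [cite: DuminilCopinSmirnov2012, §2 (domains)] -/
theorem exists_ends_of_mem_hexDomainBoundary {Λ : Finset HexVertex} {e : Sym2 HexVertex}
    (h : e ∈ hexDomainBoundary Λ) :
    ∃ u v : HexVertex, e = s(u, v) ∧ v ∈ Λ ∧ u ∉ Λ ∧ hexGraph.Adj u v := by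
  obtain ⟨he, u, v, rfl, hv, hu⟩ := h
  exact ⟨u, v, rfl, hv, hu, (SimpleGraph.mem_edgeSet hexGraph).1 he⟩

/-- **The inner end is within `δ` of the rescaled mid-edge** (`|c_v - mid| = 1/(2√3)`). [folklore] -/
theorem dist_smul_center_midpoint_le {δ : ℝ} (hδ : 0 ≤ δ) {u v : HexVertex}
    (h : hexGraph.Adj u v) :
    dist ((δ : ℂ) * hexCenter v) ((δ : ℂ) * hexMidpoint s(u, v)) ≤ δ := by
  rw [hexMidpoint_mk, dist_eq_norm, ← mul_sub, norm_mul, Complex.norm_real,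
    Real.norm_of_nonneg hδ, show hexCenter v - (hexCenter u + hexCenter v) / 2 =
      (hexCenter v - hexCenter u) / 2 by ring, norm_div, norm_hexCenter_sub_of_adj h]
  refine mul_le_of_le_one_right hδ ?_
  rw [Complex.norm_ofNat, div_le_one (by norm_num : (0 : ℝ) < 2)]
  have h1 : 1 ≤ Real.sqrt 3 := by
    rw [show (1 : ℝ) = Real.sqrt 1 by simp]; exact Real.sqrt_le_sqrt (by norm_num)
  exact (inv_le_one_of_one_le₀ h1).trans (by norm_num)

/-! ### Walks of a family from lattice paths -/

/-- **A mid-edge self-avoiding walk of the family from a lattice path inside it.**  If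
`a = {u_a, v_a} ≠ b = {u_b, v_b}` with `v_a ∈ Λ`, `u_a, u_b ∉ Λ`, `u_a ∼ v_a`, and `v_a` is joined
to `v_b` by a honeycomb path inside `Λ`, then there is a self-avoiding walk `a → b` of the vertex
domain `Λ` (extract a simple path, apply the dictionary of crux 10472).
[cite: DuminilCopinSmirnov2012, §1–§2 (walks between mid-edges)] -/
theorem nonempty_hexMidEdgeSAW_of_pathIn {Λ : Finset HexVertex} {ua va ub vb : HexVertex}
    (hva : va ∈ Λ) (hua : ua ∉ Λ) (hub : ub ∉ Λ) (ha : hexGraph.Adj va ua)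
    (hne : s(va, ua) ≠ s(vb, ub)) (hpath : PathIn hexGraph (↑Λ : Set HexVertex) va vb) :
    Nonempty (HexMidEdgeSAW Λ s(va, ua) s(vb, ub)) := by
  obtain ⟨p, hp⟩ := exists_walk_of_pathIn hpath
  obtain ⟨e, -⟩ := exists_equiv_isPath_hexMidEdgeSAW hva hua hub ha hne
  exact ⟨e ⟨(p.toPath : hexGraph.Walk va vb), p.toPath.2, fun w hw =>
    hp w (SimpleGraph.Walk.support_toPath_subset_support p hw)⟩⟩

/-- Along a chain of adjacent vertices inside `A`, every vertex is joined to the head inside `A`.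
[folklore] -/
theorem pathIn_of_isChain {V : Type*} {G : SimpleGraph V} {A : Set V} :
    ∀ (x : V) (l : List V), (x :: l).IsChain G.Adj → (∀ v ∈ x :: l, v ∈ A) →
      ∀ v ∈ x :: l, PathIn G A x v
  | x, [], _, hA, v, hv => by
    rw [List.mem_singleton] at hv
    subst hv
    exact PathIn.refl (hA _ (by simp))
  | x, y :: l, hc, hA, v, hv => by
    rw [List.isChain_cons_cons] at hc
    rcases List.mem_cons.1 hv with rfl | hv
    · exact PathIn.refl (hA _ (by simp))
    · have hy : ∀ w ∈ y :: l, w ∈ A := fun w hw => hA w (List.mem_cons_of_mem _ hw)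
      exact (PathIn.of_adj (hA x (by simp)) (hy y (by simp)) hc.1).trans
        (pathIn_of_isChain y l hc.2 hy v hv)

/-! ### The two sandwich inclusions at a fixed mesh -/

/-- **THE LOWER INCLUSION (fixed mesh).**  Let `a = {u_a, v_a}` be a boundary mid-edge of `Λ`
with inner end `v_a ∈ Λ`, `u_a ∉ Λ`, and `b ≠ a`.  A walk `γ ⊂ Λ : a → b` all of whose vertices
are at distance `> 6δ` from every point of the exclusion set `T` is a walk of the sub-family (the
component of `v_a` in the deep vertices): its vertices form a chain of deep vertices from `v_a`.
[cite: LawlerSchrammWerner2004SAW, §3.4 ("SAW satisfies restriction")] -/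
theorem verts_subset_subFamily_of_far {Λ : Finset HexVertex} {T : Set ℂ} {δ : ℝ}
    {a b : Sym2 HexVertex} {ua va : HexVertex} (hea : a = s(ua, va)) (hua : ua ∉ Λ) (hab : a ≠ b)
    (γ : HexMidEdgeSAW Λ a b)
    (hfar : ∀ v ∈ γ.verts, ∀ y ∈ T, 6 * δ < dist ((δ : ℂ) * hexCenter v) y) :
    ∀ v ∈ γ.verts, v ∈ (Λ.filter fun z => PathIn hexGraph {u : HexVertex | u ∈ Λ ∧ ∀ y ∈ T, 6 * δ < dist ((δ : ℂ) * hexCenter u) y} va z) := by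
  have hne : γ.verts ≠ [] := fun h => hab (γ.eq_of_nil h)
  obtain ⟨x, l, hxl⟩ := List.exists_cons_of_ne_nil hne
  -- the head is the inner end of `a`
  have hx : x = va := by
    have hmem : x ∈ a := γ.head_mem x (by rw [hxl]; rfl)
    rw [hea] at hmem
    rcases Sym2.mem_iff.1 hmem with h | h
    · exact absurd (γ.subset x (by rw [hxl]; simp)) (h ▸ hua)
    · exact h
  have hdeep : ∀ v ∈ x :: l, v ∈ {u : HexVertex | u ∈ Λ ∧ ∀ y ∈ T, 6 * δ < dist ((δ : ℂ) * hexCenter u) y} :=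
    fun v hv => ⟨γ.subset v (hxl ▸ hv), hfar v (hxl ▸ hv)⟩
  intro v hv
  rw [hxl] at hv
  have := pathIn_of_isChain x l (hxl ▸ γ.isChain) hdeep v hv
  rw [hx] at this
  exact mem_subFamily_iff.2 this

/-- Honeycomb neighbours are at rescaled distance `δ/√3 ≤ δ`. [folklore] -/
theorem dist_smul_hexCenter_le_of_adj {δ : ℝ} (hδ : 0 ≤ δ) {u v : HexVertex}
    (h : hexGraph.Adj u v) : dist ((δ : ℂ) * hexCenter u) ((δ : ℂ) * hexCenter v) ≤ δ := by
  rw [dist_comm, dist_eq_norm, ← mul_sub, norm_mul, Complex.norm_real, Real.norm_of_nonneg hδ,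
    norm_hexCenter_sub_of_adj h]
  refine mul_le_of_le_one_right hδ ?_
  have h1 : 1 ≤ Real.sqrt 3 := by
    rw [show (1 : ℝ) = Real.sqrt 1 by simp]; exact Real.sqrt_le_sqrt (by norm_num)
  exact inv_le_one_of_one_le₀ h1

/-- **THE UPPER INCLUSION (fixed mesh).**  If all vertices of a nonempty walk lie in a family
`Λ'` whose rescaled centres lie in `Ω'`, the curve of the walk lies in the closed
`δ`-neighbourhood of `Ω'` (`δ ≥ 0`). [folklore] -/
theorem range_latticeCurve_subset_cthickening_of_subset {Λ Λ' : Finset HexVertex} {δ : ℝ}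
    (hδ : 0 ≤ δ) {Ω' : Set ℂ} (hΛ' : ∀ v ∈ Λ', (δ : ℂ) * hexCenter v ∈ Ω')
    {a b : Sym2 HexVertex} (hab : a ≠ b) (γ : HexMidEdgeSAW Λ a b)
    (hγ : ∀ v ∈ γ.verts, v ∈ Λ') :
    (CurveClass.mk ⟨polyline (γ.verts.map fun v => ((δ : ℝ) : ℂ) * hexCenter v)⟩).range ⊆ cthickening δ Ω' :=
  range_latticeCurve_subset
    (List.IsChain.imp (fun _ _ h => dist_smul_hexCenter_le_of_adj hδ h) γ.isChain)
    (fun v hv => hΛ' v (hγ v hv)) (fun h => hab (γ.eq_of_nil h))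

/-! ### Endpoints of the curve of a walk -/

/-- The vertex list of a walk from the mid-edge `{u_a, v_a}`, `u_a ∉ Λ`, starts at `v_a`.
[cite: DuminilCopinSmirnov2012, §1–§2 (walks between mid-edges)] -/
theorem head_verts_eq {Λ : Finset HexVertex} {a b : Sym2 HexVertex} {ua va : HexVertex}
    (hea : a = s(ua, va)) (hua : ua ∉ Λ) (γ : HexMidEdgeSAW Λ a b) (hne : γ.verts ≠ []) :
    γ.verts.head hne = va := by
  have key : ∀ w : HexVertex, w ∈ a → w ∈ Λ → w = va := by
    intro w hw hwΛ
    rw [hea] at hw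
    rcases Sym2.mem_iff.1 hw with h | h
    · exact absurd hwΛ (h ▸ hua)
    · exact h
  exact key _ (γ.head_mem _ (List.head?_eq_some_head hne)) (γ.subset _ (List.head_mem hne))

/-- The vertex list of a walk to the mid-edge `{u_b, v_b}`, `u_b ∉ Λ`, ends at `v_b`.
[cite: DuminilCopinSmirnov2012, §1–§2 (walks between mid-edges)] -/
theorem getLast_verts_eq {Λ : Finset HexVertex} {a b : Sym2 HexVertex} {ub vb : HexVertex}
    (heb : b = s(ub, vb)) (hub : ub ∉ Λ) (γ : HexMidEdgeSAW Λ a b) (hne : γ.verts ≠ []) :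
    γ.verts.getLast hne = vb := by
  have key : ∀ w : HexVertex, w ∈ b → w ∈ Λ → w = vb := by
    intro w hw hwΛ
    rw [heb] at hw
    rcases Sym2.mem_iff.1 hw with h | h
    · exact absurd hwΛ (h ▸ hub)
    · exact h
  exact key _ (γ.getLast_mem _ (List.getLast?_eq_some_getLast hne))
    (γ.subset _ (List.getLast_mem hne))

/-- **The curve of a walk starts within `δ` of the rescaled source mid-edge** (a boundary
mid-edge). [folklore] -/
theorem dist_source_latticeCurve_le {Λ : Finset HexVertex} {a b : Sym2 HexVertex} {δ : ℝ}
    (hδ : 0 ≤ δ) (ha : a ∈ hexDomainBoundary Λ) (hab : a ≠ b) (γ : HexMidEdgeSAW Λ a b) :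
    dist (CurveClass.mk ⟨polyline (γ.verts.map fun v => ((δ : ℝ) : ℂ) * hexCenter v)⟩).source
      ((δ : ℂ) * hexMidpoint a) ≤ δ := by
  obtain ⟨ua, va, hea, -, hua, hadj⟩ := exists_ends_of_mem_hexDomainBoundary ha
  have hne : γ.verts ≠ [] := fun h => hab (γ.eq_of_nil h)
  rw [source_latticeCurve hne, head_verts_eq hea hua γ hne]
  have : (δ : ℂ) * hexMidpoint a = (δ : ℂ) * hexMidpoint s(ua, va) := by rw [hea]
  rw [this]
  exact dist_smul_center_midpoint_le hδ hadj

/-- **The curve of a walk ends within `δ` of the rescaled target mid-edge** (a boundary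
mid-edge). [folklore] -/
theorem dist_target_latticeCurve_le {Λ : Finset HexVertex} {a b : Sym2 HexVertex} {δ : ℝ}
    (hδ : 0 ≤ δ) (hb : b ∈ hexDomainBoundary Λ) (hab : a ≠ b) (γ : HexMidEdgeSAW Λ a b) :
    dist (CurveClass.mk ⟨polyline (γ.verts.map fun v => ((δ : ℝ) : ℂ) * hexCenter v)⟩).target
      ((δ : ℂ) * hexMidpoint b) ≤ δ := by
  obtain ⟨ub, vb, heb, -, hub, hadj⟩ := exists_ends_of_mem_hexDomainBoundary hb
  have hne : γ.verts ≠ [] := fun h => hab (γ.eq_of_nil h)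
  rw [target_latticeCurve hne, getLast_verts_eq heb hub γ hne]
  have : (δ : ℂ) * hexMidpoint b = (δ : ℂ) * hexMidpoint s(ub, vb) := by rw [heb]
  rw [this]
  exact dist_smul_center_midpoint_le hδ hadj

/-! ### Registry form -/

/-- **Registered sub-goal `stub_twoPieceAdmIdentification_mesh`** (crux item stmt-CriticalPhenomena-14005, line
`bridge-gate-renewal`, stub `stub_twoPieceAdmIdentification`): registry form of `nonempty_hexMidEdgeSAW_of_pathIn` — a lattice path inside a family between the inner ends of two distinct boundary mid-edges gives a mid-edge self-avoiding walk. [cite: DuminilCopinSmirnov2012, §1–§2 (walks between mid-edges)] -/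
theorem stub_twoPieceAdmIdentification_mesh :
    ∀ (Λ : Finset HexVertex) (ua va ub vb : HexVertex), va ∈ Λ → ua ∉ Λ → ub ∉ Λ →
      hexGraph.Adj va ua → s(va, ua) ≠ s(vb, ub) → PathIn hexGraph (↑Λ : Set HexVertex) va vb →
      Nonempty (HexMidEdgeSAW Λ s(va, ua) s(vb, ub)) :=
  fun _ _ _ _ _ hva hua hub ha hne hpath => nonempty_hexMidEdgeSAW_of_pathIn hva hua hub ha hne hpath

end Summit.CriticalPhenomena.SAWScalingLimit.Theorems.ObservableToSLER.TwoPiece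

end
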